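import Literature.NumberTheory.Sieve.IwaniecAlmostPrimesQuadraticProp2Prep
import Literature.NumberTheory.Sieve.IwaniecAlmostPrimesQuadraticSection6
import HarnessLib

/-!
# Iwaniec (1978) for a general quadratic: Proposition 2 (upper bound) for `𝒜_G` from Lemma 2 and the level of distribution of `𝒜_G` — PROVED

General-`G` counterpart of `IwaniecAlmostPrimesProp2.lean` (H. Iwaniec, *Almost-primes represented
by quadratic polynomials*, Invent. Math. **47** (1978) 171–188, Proposition 2 (p. 185) and its
proof (pp. 185–186) [cite: IwaniecInventiones1978, Proposition 2]; R. J. Lemke Oliver, Acta Arith.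
**151** (2012) 241–261, Lemma 5: "This is essentially the same as Proposition 2 in [8], so we
present it without proof" [cite: LemkeOliverActaArith2012, Lemma 5]).  Given Iwaniec's
bilinear-remainder linear sieve (`lemma2_bilinearSieve`, Acta Arith. 37 (1980) Thm 1, a named fact
of the first file) and the level of distribution `x^{16/15}` of `𝒜_G = {G(n) : n ≤ x}` in bilinear
form — Iwaniec's Corollary of Proposition 1 for general `G` (p. 176; Lemke Oliver's Lemma 3 with
his §3), stated here as the PREDICATE `proposition1G_corollary a b c` — this file PROVES

* `proposition2G_upper_of : lemma2_bilinearSieve → proposition1G_corollary a b c →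
   proposition2G_upper a b c` — the upper half of Proposition 2 for `𝒜_G` exactly as stated in
  `IwaniecAlmostPrimesQuadraticSection6.lean`, the Mertens inputs for `ρ_G` (conditions (1), (2) of
  Lemma 2, the tail of Mertens II) being PROVED in `IwaniecAlmostPrimesQuadraticMertens.lean` /
  `IwaniecAlmostPrimesQuadraticProp2Prep.lean`.

Consistency: `proposition1G_corollary_one_zero_one_iff : proposition1G_corollary 1 0 1 ↔
proposition1_corollary` (`remG 1 0 1 = rem`, `rhoG 1 0 1 = rho`).

The proof is that of the `n² + 1` file verbatim (classes `H(Q, Z)` indexed by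
`(⌊log₂ q⌋, ⌊log₂(z_q/z)⌋)`, common sieving level `u = min(Z_c, (MN)^{1/2})`, `M = x^{1−4ε'}/2^{i+1}`,
`N = x^{1/15−ε'}`, `ε' = ε/1000`, Lemma 2 with `ε₂ = ε/4`; remainders of a class through
`abs_remainder_class_leG` and the level of distribution, main terms through `main_term_upper_gen`,
`densityProd_level_le_gen`), with `ρ, V, Λ₀, S, r` replaced by their `G`-versions.  No named fact
is introduced (`proposition1G_corollary` is a definition with parameters, used as a hypothesis).

## References

* H. Iwaniec, Invent. Math. 47 (1978) 171–188, Proposition 1 (Corollary p. 176), Proposition 2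
  and §5 (`IwaniecInventiones1978`).
* H. Iwaniec, Acta Arith. 37 (1980) 307–320, Theorem 1 (`IwaniecActaArith1980b`).
* R. J. Lemke Oliver, Acta Arith. 151 (2012) 241–261, Lemmas 3, 5 (`LemkeOliverActaArith2012`).
-/

open Finset Real Polynomial Filter
open scoped Topology

noncomputable section

namespace Literature.NumberTheory.Sieve.Iwaniec1978

variable {a b c : ℤ}

/-! ### The level of distribution of `𝒜_G` in bilinear form — the statement (predicate) -/

/-- **Iwaniec's Corollary of Proposition 1 (p. 176) for `𝒜_G`: level of distribution `x^{16/15}`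
in bilinear form — the STATEMENT, as a predicate of the coefficients.**  For every `ε > 0`,
uniformly in real `b_n` with `|b_n| ≤ 1` supported on squarefree `n`:
`∑_{m < x^{1−4ε}} |∑_{n < x^{1/15−ε}, (n,m)=1} b_n r(𝒜; mn)| ≪_ε x^{1−ε}`, `𝒜 = 𝒜_G`,
`r(𝒜; d) = |𝒜_d| − ρ_G(d) x/d`.  Iwaniec proves it for `n² + 1` (dispersion method, Lemma 4 via
the Gaussian integers, Hooley's Kloosterman-sum bound) and states that the general case is similar;
Lemke Oliver (Lemma 3 and §3) obtains a level `x^{1+γ₀−ε}` for every irreducible quadratic, with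
`γ₀ = (1 − α₀)/(2(1 + β₀)) > 0` in terms of the exponents `α₀ < 1`, `β₀ ≥ 1` of his Lemma 4 (so
`γ₀ ≤ 1/16 < 1/15` when `α₀ = 3/4`: his printed level is below `x^{16/15}` in general, and
the `x^{16/15}` of this predicate for a general `G` is Iwaniec's claim).  This is
`proposition1_corollary` with
`B(x; m, N)` replaced by `bilinearBG`; used below only as a hypothesis.
[cite: IwaniecInventiones1978, Corollary p. 176] -/
def proposition1G_corollary (a b c : ℤ) : Prop :=
  ∀ ε : ℝ, 0 < ε → ∃ C : ℝ, ∀ (x : ℝ) (bc : ℕ → ℝ), 2 ≤ x →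
    (∀ n, |bc n| ≤ 1) → (∀ n, ¬ Squarefree n → bc n = 0) →
      ∑ m ∈ Finset.Ico 1 ⌈x ^ (1 - 4 * ε)⌉₊, |bilinearBG a b c x bc m (x ^ (1 / 15 - ε))| ≤
        C * x ^ (1 - ε)


/-! ### Consistency with `n² + 1`: `proposition1G_corollary 1 0 1 ↔ proposition1_corollary` -/

/-- `ρ_G = ρ` for `G = X² + 1`. [folklore] -/
theorem rhoG_one_zero_one (d : ℕ) : rhoG 1 0 1 d = rho d := by
  rw [rhoG, quadPoly_one_zero_one, rho_eq_polyRootCountMod]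

/-- `|G(n)| = n² + 1` for `G = X² + 1`. [folklore] -/
theorem gAbs_one_zero_one (n : ℕ) : gAbs 1 0 1 n = n ^ 2 + 1 := natAbs_quad_one_zero_one n

/-- `|𝒜_d|` for `G = X² + 1` is the `n² + 1` count `congrCount`. [folklore] -/
theorem congrCountG_one_zero_one (x : ℝ) (d : ℕ) : congrCountG 1 0 1 x d = congrCount x d := by
  classical
  unfold congrCountG congrCount
  simp only [gAbs_one_zero_one]

/-- `r(𝒜; d)` for `G = X² + 1` is the `n² + 1` remainder `rem`. [folklore] -/
theorem remG_one_zero_one (x : ℝ) (d : ℕ) : remG 1 0 1 x d = rem x d := by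
  rw [remG, rem, congrCountG_one_zero_one, rhoG_one_zero_one]

/-- `B(x; m, N)` for `G = X² + 1` is the `n² + 1` bilinear form `bilinearB`. [folklore] -/
theorem bilinearBG_one_zero_one (x : ℝ) (bc : ℕ → ℝ) (m : ℕ) (N : ℝ) :
    bilinearBG 1 0 1 x bc m N = bilinearB x bc m N := by
  unfold bilinearBG bilinearB
  simp only [remG_one_zero_one]

/-- **The level of distribution of `𝒜_G` for `G = X² + 1` is Iwaniec's Corollary of Proposition 1
verbatim**: `proposition1G_corollary 1 0 1 ↔ proposition1_corollary` (so the PROVED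
`proposition1_corollary_of : proposition1 → proposition1_corollary` of the `n² + 1` files feeds the
general theorems below at `G = X² + 1`). [cite: IwaniecInventiones1978, Corollary p. 176] -/
theorem proposition1G_corollary_one_zero_one_iff :
    proposition1G_corollary 1 0 1 ↔ proposition1_corollary := by
  unfold proposition1G_corollary proposition1_corollary
  simp only [bilinearBG_one_zero_one]

/-! ### Proposition 2 for `𝒜_G`, upper bound, from Lemma 2 and the level of distribution -/

/-- `C ≥ 0` in the Corollary of Proposition 1 (apply it to `b = 0`). [folklore] -/
theorem prop1G_corollary_const_nonneg {ε' C : ℝ}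
    (hC : ∀ (x : ℝ) (bc : ℕ → ℝ), 2 ≤ x → (∀ n, |bc n| ≤ 1) → (∀ n, ¬ Squarefree n → bc n = 0) →
      ∑ m ∈ Finset.Ico 1 ⌈x ^ (1 - 4 * ε')⌉₊, |bilinearBG a b c x bc m (x ^ (1 / 15 - ε'))| ≤
        C * x ^ (1 - ε')) : 0 ≤ C := by
  have h := hC 2 (fun _ => 0) le_rfl (by simp) (by simp)
  have h0 : ∑ m ∈ Finset.Ico 1 ⌈(2 : ℝ) ^ (1 - 4 * ε')⌉₊,
      |bilinearBG a b c 2 (fun _ => (0 : ℝ)) m ((2 : ℝ) ^ (1 / 15 - ε'))| = 0 := by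
    refine Finset.sum_eq_zero fun m _ => ?_
    simp [bilinearBG]
  rw [h0] at h
  have : (0 : ℝ) < (2 : ℝ) ^ (1 - ε') := Real.rpow_pos_of_pos two_pos _
  exact (mul_nonneg_iff_of_pos_right this).mp h

set_option maxHeartbeats 800000 in
/-- **Proposition 2 for `𝒜_G` (upper bound) from Lemma 2 and the level of distribution of `𝒜_G`
— PROVED** (pp. 185–186; Lemke Oliver, Lemma 5), the Mertens inputs for `ρ_G` being proved in
`IwaniecAlmostPrimesQuadraticMertens.lean` and `IwaniecAlmostPrimesQuadraticProp2Prep.lean`.  The classes `H(Q, Z)` are indexed by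
`(⌊log₂ q⌋, ⌊log₂(z_q/z)⌋)`; in a class every `q` is sieved at the common level
`u = min(Z_c, (M N)^{1/2})` (`S(𝒜_q, z_q) ≤ S(𝒜_q, u)`), with `M = x^{1−4ε'}/2^{⌊log₂ q⌋+1}`,
`N = x^{1/15−ε'}`, `ε' = ε/1000`, Lemma 2 being used with `ε₂ = ε/4`; the remainders of a class
are bounded by the level of distribution via `abs_remainder_class_leG`, the main terms by
`main_term_upper_gen` and `densityProd_level_le_gen`, and the number of classes by `(⌊log₂ x⌋ + 1)²`.
[cite: IwaniecInventiones1978, Proposition 2] -/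
theorem proposition2G_upper_of (ha : 0 < a) (hc : Odd c) (hirr : Irreducible (quadPoly a b c))
    (h2 : lemma2_bilinearSieve) (h1c : proposition1G_corollary a b c) :
    proposition2G_upper a b c := by
  intro F f hFf γ hγ hγ2
  have hΛ0pos := lambda0G_pos ha hc hirr
  have hVpos := densityProdG_pos ha hc hirr
  -- constants depending on `γ`, `F` and `G`
  obtain ⟨c₀, K, L₂, hc₀, hK1, hL₂1, HL2⟩ := lemma2_multisetAqG h2 ha hc hirr
  obtain ⟨Rγ, hRγ0, hRev⟩ := eventually_sum_rough_rhoG_div_le ha hc hirr hγ (by linarith)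
  obtain ⟨Lg, hLip⟩ := hFf.exists_lipschitzOnWith_mul_upper (a := 1 / 10)
    (b := 16 / (15 * γ) + 2) (by norm_num)
  obtain ⟨Gmax, hGmax⟩ : ∃ Gmax : ℝ, ∀ s ∈ Set.Icc (1 / 10 : ℝ) (16 / (15 * γ) + 2),
      |s * F s| ≤ Gmax := by
    obtain ⟨C, hC⟩ := isCompact_Icc.exists_bound_of_continuousOn
      (hFf.continuousOn_mul_upper (a := 1 / 10) (b := 16 / (15 * γ) + 2) (by norm_num))
    exact ⟨C, fun s hs => by simpa [Real.norm_eq_abs] using hC s hs⟩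
  set C₃ : ℝ := 10 * (Gmax + 4 * Lg / γ) with hC₃
  set C₄ : ℝ := 1 / γ + 33 with hC₄
  have hGmax0 : 0 ≤ Gmax := by
    have h2mem : (2 : ℝ) ∈ Set.Icc (1 / 10 : ℝ) (16 / (15 * γ) + 2) :=
      ⟨by norm_num, by linarith [show (0 : ℝ) < 16 / (15 * γ) by positivity]⟩
    exact (abs_nonneg _).trans (hGmax 2 h2mem)
  have hC₃0 : 0 ≤ C₃ := by positivity
  have hC₄0 : 0 < C₄ := by positivity
  refine ⟨(C₃ + c₀ * C₄) * Rγ + 1, fun ε hε => ?_⟩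
  -- the case `ε ≥ 1` is vacuous (no `q` with `1 ≤ q < x^{1−ε} ≤ 1`)
  rcases le_or_gt 1 ε with hε1 | hε1
  · refine ⟨1, fun x hx zq cq hzq hcq => ?_⟩
    dsimp only
    have hempty : Finset.Ico 1 ⌈x ^ (1 - ε)⌉₊ = ∅ := by
      have h1 : x ^ (1 - ε) ≤ 1 := Real.rpow_le_one_of_one_le_of_nonpos hx (by linarith)
      have h2 : ⌈x ^ (1 - ε)⌉₊ ≤ 1 := by
        have := Nat.ceil_le_ceil h1
        rwa [Nat.ceil_one] at this
      exact Finset.Ico_eq_empty_of_le h2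
    rw [hempty, Finset.filter_empty, Finset.sum_empty, Finset.sum_empty, zero_add]
    have : 0 ≤ densityProdG a b c (x ^ γ) * x := mul_nonneg (hVpos _).le (by linarith)
    positivity
  -- main case `0 < ε < 1`: parameters
  set ε' : ℝ := ε / 1000 with hε'
  set ε₂ : ℝ := ε / 4 with hε₂
  have hε'0 : 0 < ε' := by positivity
  have hε'ε : ε' ≤ ε / 1000 := le_rfl
  have hε₂0 : 0 < ε₂ := by positivity
  have hε₂3 : ε₂ < 1 / 3 := by rw [hε₂]; linarith
  obtain ⟨C₁, hC₁⟩ := h1c ε' hε'0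
  have hC₁0 : 0 ≤ C₁ := prop1G_corollary_const_nonneg hC₁
  set Nx : ℝ → ℝ := fun x => max (x ^ (1 / 15 - ε')) 2 with hNx
  set Mi : ℝ → ℕ → ℝ := fun x i => max (x ^ (1 - 4 * ε') / 2 ^ (i + 1)) 2 with hMi
  have hNx1 : ∀ x, 1 < Nx x := fun x => lt_of_lt_of_le one_lt_two (le_max_right _ _)
  have hMi1 : ∀ x i, 1 < Mi x i := fun x i => lt_of_lt_of_le one_lt_two (le_max_right _ _)
  -- Lemma 2's coefficients for every `(x, i)`
  choose Lc au bu al bl hLc hau hbu hal hbl Hq using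
    fun (x : ℝ) (i : ℕ) => HL2 F f hFf ε₂ (Mi x i) (Nx x) hε₂0 hε₂3 (hMi1 x i) (hNx1 x)
  set Lmax : ℝ := Real.exp (8 * ε₂⁻¹ ^ 3) with hLmax
  have hLmax0 : 0 ≤ Lmax := (Real.exp_pos _).le
  set B : ℝ := ε₂⁻¹ ^ 8 * Real.exp (K + L₂) with hB
  have hB0 : 0 ≤ B := by positivity
  -- largeness conditions on `x`
  have hγ33 : 0 < min γ (1 / 33) := lt_min hγ (by norm_num)
  have EV : ∀ᶠ x : ℝ in atTop,
      2 ≤ x ∧ (2 : ℝ) ≤ x ^ γ ∧ (2 : ℝ) ≤ x ^ (1 / 15 - ε') ∧ (4 : ℝ) ≤ x ^ (ε - 4 * ε') ∧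
      Real.log 2 ≤ ε' * Real.log x ∧ 1 / Real.log x ≤ ε * γ / 2 ∧
      (∀ t : ℝ, x ^ (min γ (1 / 33)) ≤ t →
        |densityProdG a b c t * Real.log t - lambda0G a b c| ≤ ε / 8 * lambda0G a b c) ∧
      (∀ T : ℝ, 0 < T → Real.log x / 16 ≤ Real.log T →
        B * Real.log T ^ (-(1 / 3 : ℝ)) ≤ 3 * ε / 4) ∧
      (∀ T : Finset ℕ, (∀ q ∈ T, 1 ≤ q ∧ (q : ℝ) < x ∧ q.Coprime (primesProdBelow (x ^ γ))) →
        ∑ q ∈ T, (rhoG a b c q : ℝ) / q ≤ Rγ) ∧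
      ((⌊Real.logb 2 x⌋₊ : ℝ) + 1) ^ 2 * (Lmax * C₁) * x ^ (1 - ε') ≤
        (ε * (7 / 8 * lambda0G a b c) / γ) * x / Real.log x := by
    have e1 := eventually_ge_atTop (2 : ℝ)
    have e2 := (tendsto_rpow_atTop hγ).eventually_ge_atTop (2 : ℝ)
    have e3 := (tendsto_rpow_atTop (show 0 < 1 / 15 - ε' by rw [hε']; linarith)).eventually_ge_atTop (2 : ℝ)
    have e4 := (tendsto_rpow_atTop (show 0 < ε - 4 * ε' by rw [hε']; linarith)).eventually_ge_atTop (4 : ℝ)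
    have e5 : ∀ᶠ x : ℝ in atTop, Real.log 2 ≤ ε' * Real.log x :=
      (Real.tendsto_log_atTop.const_mul_atTop hε'0).eventually_ge_atTop _
    have e6 : ∀ᶠ x : ℝ in atTop, 1 / Real.log x ≤ ε * γ / 2 := by
      have : Tendsto (fun x : ℝ => 1 / Real.log x) atTop (𝓝 0) :=
        tendsto_const_nhds.div_atTop Real.tendsto_log_atTop
      exact (this.eventually (ge_mem_nhds (by positivity))).mono fun x hx => hx
    have e7 := eventually_forall_abs_densityProdG_mul_log_sub_le ha hc hirr
      (show 0 < ε / 8 * lambda0G a b c by positivity) hγ33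
    have e8 := eventually_E_small hB0 (show 0 < 3 * ε / 4 by positivity)
    have e9 := hRev
    have e10 := eventually_classes_remainder_le (A := Lmax * C₁) (by positivity)
      (show 0 < ε * (7 / 8 * lambda0G a b c) / γ by positivity) hε'0
    filter_upwards [e1, e2, e3, e4, e5, e6, e7, e8, e9, e10] with x h1 h2 h3 h4 h5 h6 h7 h8 h9 h10
    exact ⟨h1, h2, h3, h4, h5, h6, h7, h8, h9, h10⟩
  obtain ⟨x₀, hx₀⟩ := Filter.eventually_atTop.mp EV
  refine ⟨x₀, fun x hx zq cq hzq hcq => ?_⟩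
  obtain ⟨hx2, hxγ, hxN, hx4, hlog2, hlogx, hΛ, hE, hR, hrem⟩ := hx₀ x hx
  dsimp only
  set Q := (Finset.Ico 1 ⌈x ^ (1 - ε)⌉₊).filter fun q : ℕ => q.Coprime (primesProdBelow (zq q))
    with hQ
  -- basic facts about `x`
  have hx1 : 1 < x := by linarith
  have hx0 : 0 < x := by linarith
  set L := Real.log x with hL
  have hL0 : 0 < L := Real.log_pos hx1
  set z := x ^ γ with hz
  have hz0 : 0 < z := Real.rpow_pos_of_pos hx0 γ
  have hz1 : 1 ≤ z := by linarith
  have hlz : Real.log z = γ * L := Real.log_rpow hx0 γ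
  set N := x ^ (1 / 15 - ε') with hN
  have hNx_eq : Nx x = N := max_eq_left hxN
  have hN2 : 2 ≤ N := hxN
  set D := x ^ (1 - 4 * ε') with hD
  have hD0 : 0 < D := Real.rpow_pos_of_pos hx0 _
  have hxε : x ^ (1 - ε) < x := by
    conv_rhs => rw [← Real.rpow_one x]
    exact Real.rpow_lt_rpow_of_exponent_lt hx1 (by linarith)
  have hxa : x ^ (min γ (1 / 33)) ≤ z :=
    Real.rpow_le_rpow_of_exponent_le hx1.le (min_le_left _ _)
  -- `Λ` at `z`
  have hΛz := hΛ z hxa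
  set Λz := densityProdG a b c z * Real.log z with hΛz_def
  have hΛz_lo : 7 / 8 * lambda0G a b c ≤ Λz := by
    have := (abs_le.mp hΛz).1
    have hε8 : ε / 8 * lambda0G a b c ≤ 1 / 8 * lambda0G a b c :=
      mul_le_mul_of_nonneg_right (by linarith) hΛ0pos.le
    linarith
  have hVz : densityProdG a b c z = Λz / Real.log z := by
    rw [hΛz_def, hlz]; field_simp
  -- membership facts for `q ∈ Q`
  have hQmem : ∀ q ∈ Q, 1 ≤ q ∧ (q : ℝ) < x ^ (1 - ε) ∧ q.Coprime (primesProdBelow (zq q)) := by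
    intro q hq
    rw [hQ, Finset.mem_filter, Finset.mem_Ico] at hq
    exact ⟨hq.1.1, Nat.lt_ceil.mp hq.1.2, hq.2⟩
  -- per-`q` data
  set iq : ℕ → ℕ := fun q => Nat.log 2 q with hiq
  set jq : ℕ → ℕ := fun q => Nat.log 2 ⌊zq q / z⌋₊ with hjq
  set Zc : ℕ → ℝ := fun q => z * 2 ^ jq q with hZc
  set uk : ℕ × ℕ → ℝ := fun k => min (z * 2 ^ k.2) ((Mi x k.1 * Nx x) ^ (1 / 2 : ℝ)) with huk
  set uq : ℕ → ℝ := fun q => uk (iq q, jq q) with huq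
  have huq_eq : ∀ q, uq q = min (Zc q) ((Mi x (iq q) * Nx x) ^ (1 / 2 : ℝ)) := fun q => rfl
  -- (d1) dyadic range of `q`
  have hd1 : ∀ q ∈ Q, (2 : ℝ) ^ iq q ≤ q ∧ (q : ℝ) < 2 * 2 ^ iq q := by
    intro q hq
    have hq1 := (hQmem q hq).1
    constructor
    · have := Nat.pow_log_le_self 2 (by omega : q ≠ 0)
      exact_mod_cast this
    · have := Nat.lt_pow_succ_log_self (by norm_num : 1 < 2) q
      have h' : (q : ℝ) < ((2 ^ (Nat.log 2 q + 1) : ℕ) : ℝ) := by exact_mod_cast this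
      simpa [pow_succ, mul_comm] using h'
  -- (d2) `Mi x (iq q) = D / 2^{iq+1}` and `q · M ≤ D`
  have hd2 : ∀ q ∈ Q, Mi x (iq q) = D / 2 ^ (iq q + 1) ∧ (q : ℝ) * Mi x (iq q) ≤ D := by
    intro q hq
    obtain ⟨hq1, hqx, -⟩ := hQmem q hq
    obtain ⟨hlo, hhi⟩ := hd1 q hq
    have hq0 : (0 : ℝ) < q := by exact_mod_cast hq1
    have hpow : (0 : ℝ) < 2 ^ (iq q + 1) := by positivity
    -- `D / 2^{iq+1} ≥ 2`
    have hge2 : (2 : ℝ) ≤ D / 2 ^ (iq q + 1) := by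
      rw [le_div_iff₀ hpow]
      have h1 : (2 : ℝ) ^ (iq q + 1) ≤ 2 * q := by rw [pow_succ]; linarith
      have h2 : 2 * (q : ℝ) * 4 ≤ 2 * x ^ (1 - ε) * x ^ (ε - 4 * ε') := by
        have := mul_le_mul hqx.le hx4 (by norm_num) (by positivity)
        linarith
      have h3 : x ^ (1 - ε) * x ^ (ε - 4 * ε') = D := by
        rw [hD, ← Real.rpow_add hx0]; ring_nf
      have h2' : 2 * (q : ℝ) * 4 ≤ 2 * D := by rw [← h3]; linarith [h2]
      linarith
    have hM : Mi x (iq q) = D / 2 ^ (iq q + 1) := max_eq_left hge2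
    refine ⟨hM, ?_⟩
    rw [hM]
    rw [mul_div_assoc', div_le_iff₀ hpow, pow_succ]
    have h5 := mul_le_mul_of_nonneg_right hhi.le hD0.le
    have e5 : 2 * (2 : ℝ) ^ iq q * D = D * (2 ^ iq q * 2) := by ring
    linarith
  -- (d4) the size of `log(M N)` against `log(y/q)`
  have hd4 : ∀ q ∈ Q, 0 < Mi x (iq q) * Nx x ∧
      Real.log (x ^ (16 / 15 : ℝ) / q) - 6 * ε' * L ≤ Real.log (Mi x (iq q) * Nx x) ∧
      Real.log (Mi x (iq q) * Nx x) ≤ Real.log (x ^ (16 / 15 : ℝ) / q) ∧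
      L / 16 ≤ Real.log (Mi x (iq q) * Nx x) := by
    intro q hq
    obtain ⟨hq1, hqx, -⟩ := hQmem q hq
    obtain ⟨hlo, hhi⟩ := hd1 q hq
    obtain ⟨hM, -⟩ := hd2 q hq
    have hq0 : (0 : ℝ) < q := by exact_mod_cast hq1
    have hpow : (0 : ℝ) < 2 ^ (iq q + 1) := by positivity
    have hMN0 : 0 < Mi x (iq q) * Nx x := mul_pos (by linarith [hMi1 x (iq q)]) (by linarith [hNx1 x])
    refine ⟨hMN0, ?_⟩
    rw [hM, hNx_eq, Real.log_mul (by positivity) (by positivity), Real.log_div hD0.ne' hpow.ne',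
      hD, hN, Real.log_rpow hx0, Real.log_rpow hx0, Real.log_pow,
      Real.log_div (by positivity) hq0.ne', Real.log_rpow hx0]
    -- `iq log 2 ≤ log q < (iq + 1) log 2`
    have hlq_lo : (iq q : ℝ) * Real.log 2 ≤ Real.log q := by
      rw [← Real.log_pow]; exact Real.log_le_log (by positivity) hlo
    have hlq_hi : Real.log q < ((iq q : ℝ) + 1) * Real.log 2 := by
      have := Real.log_lt_log hq0 hhi
      rw [Real.log_mul (by norm_num) (by positivity), Real.log_pow] at this
      linarith
    have hl2 : 0 < Real.log 2 := Real.log_pos (by norm_num)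
    have hlogq : Real.log q < (1 - ε) * L := by
      rw [← Real.log_rpow hx0]; exact Real.log_lt_log hq0 hqx
    have hε'L_eq : ε' * L = ε * L / 1000 := by rw [hε']; ring
    have hεL_lt : ε * L < L := mul_lt_of_lt_one_left hL0 hε1
    have hεL0 : 0 < ε * L := mul_pos hε hL0
    push_cast
    rw [← hL]
    refine ⟨by linarith, by linarith, by linarith⟩
  -- (d5) the dyadic floor of `zq q`
  have hd5 : ∀ q ∈ Q, Zc q ≤ zq q ∧ zq q < 2 * Zc q ∧ z ≤ Zc q := by
    intro q _
    have hr : 1 ≤ zq q / z := by rw [le_div_iff₀ hz0, one_mul]; exact (hzq q).1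
    obtain ⟨h1, h2⟩ := dyadicFloor_spec hr
    refine ⟨?_, ?_, ?_⟩
    · have := mul_le_mul_of_nonneg_left h1 hz0.le
      rw [mul_div_cancel₀ _ hz0.ne'] at this
      exact this
    · have := mul_lt_mul_of_pos_left h2 hz0
      rw [mul_div_cancel₀ _ hz0.ne'] at this
      simp only [hZc]; linarith
    · simp only [hZc]
      have : (1 : ℝ) ≤ 2 ^ jq q := one_le_pow₀ (by norm_num)
      exact le_mul_of_one_le_right hz0.le this
  -- (d6) the class indices are at most `⌊log₂ x⌋`
  have hd6 : ∀ q ∈ Q, iq q ≤ ⌊Real.logb 2 x⌋₊ ∧ jq q ≤ ⌊Real.logb 2 x⌋₊ := by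
    intro q hq
    obtain ⟨hq1, hqx, -⟩ := hQmem q hq
    have hxhalf : x ^ (1 / 2 : ℝ) ≤ x := by
      conv_rhs => rw [← Real.rpow_one x]
      exact Real.rpow_le_rpow_of_exponent_le hx1.le (by norm_num)
    constructor
    · exact le_floor_logb_of_pow_le hx0 ((hd1 q hq).1.trans (hqx.le.trans hxε.le))
    · refine le_floor_logb_of_pow_le hx0 ?_
      have h1 := (dyadicFloor_spec (show 1 ≤ zq q / z by
        rw [le_div_iff₀ hz0, one_mul]; exact (hzq q).1)).1
      have h2 : zq q / z ≤ zq q := div_le_self (le_of_lt (lt_of_lt_of_le hz0 (hzq q).1)) hz1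
      exact h1.trans (h2.trans ((hzq q).2.le.trans hxhalf))
  -- (d7) the level `u`
  have hd7 : ∀ q ∈ Q, 2 ≤ uq q ∧ uq q ≤ (Mi x (iq q) * Nx x) ^ (1 / 2 : ℝ) ∧ uq q ≤ zq q ∧
      x ^ (min γ (1 / 33)) ≤ uq q ∧ q.Coprime (primesProdBelow (uq q)) := by
    intro q hq
    obtain ⟨hq1, hqx, hcop⟩ := hQmem q hq
    obtain ⟨hZ1, hZ2, hZ3⟩ := hd5 q hq
    have hMN4 : (4 : ℝ) ≤ Mi x (iq q) * Nx x := by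
      have := mul_le_mul (le_max_right _ _ : (2 : ℝ) ≤ Mi x (iq q)) (le_max_right _ _ : (2 : ℝ) ≤ Nx x)
        (by norm_num) (by linarith [hMi1 x (iq q)])
      linarith
    have hsqrt2 : (2 : ℝ) ≤ (Mi x (iq q) * Nx x) ^ (1 / 2 : ℝ) := by
      have h4 : (4 : ℝ) ^ (1 / 2 : ℝ) = 2 := by
        rw [show (4 : ℝ) = (2 : ℝ) ^ (2 : ℝ) by norm_num, ← Real.rpow_mul (by norm_num)]
        norm_num
      calc (2 : ℝ) = (4 : ℝ) ^ (1 / 2 : ℝ) := h4.symm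
        _ ≤ (Mi x (iq q) * Nx x) ^ (1 / 2 : ℝ) :=
          Real.rpow_le_rpow (by norm_num) hMN4 (by norm_num)
    have hule : uq q ≤ Zc q := min_le_left _ _
    refine ⟨le_min (hxγ.trans hZ3) hsqrt2, min_le_right _ _, hule.trans hZ1, ?_,
      Nat.Coprime.coprime_dvd_right (primesProdBelow_dvd_of_le (hule.trans hZ1)) hcop⟩
    -- `x^a ≤ u`: both `Zc ≥ z ≥ x^a` and `(MN)^{1/2} ≥ N^{1/2} ≥ x^{1/33}`
    refine le_min (hxa.trans hZ3) ?_
    have h1 : x ^ (min γ (1 / 33)) ≤ x ^ ((1 / 15 - ε') * (1 / 2)) :=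
      Real.rpow_le_rpow_of_exponent_le hx1.le ((min_le_right _ _).trans (by rw [hε']; linarith))
    refine h1.trans ?_
    rw [Real.rpow_mul hx0.le, ← hN, ← hNx_eq]
    refine Real.rpow_le_rpow (by linarith [hNx1 x]) ?_ (by norm_num)
    exact le_mul_of_one_le_left (by linarith [hNx1 x]) (hMi1 x (iq q)).le
  -- the remainder attached to `q` and the per-`q` inequality
  set RR : ℕ → ℝ → ℕ → ℕ → ℝ := fun i u l q =>
    ∑ m ∈ Finset.Ico 1 ⌈Mi x i⌉₊, ∑ n ∈ Finset.Ico 1 ⌈Nx x⌉₊,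
      (if m * n ∣ primesProdBelow u then au x i l m * bu x i l n * remG a b c x (q * (m * n)) else 0)
    with hRR
  set Rq : ℕ → ℝ := fun q => ∑ l ∈ Finset.range (Lc x (iq q)), RR (iq q) (uq q) l q with hRq
  set C' : ℝ := C₃ + c₀ * C₄ with hC'
  have hkey : ∀ q ∈ Q, cq q * (siftedCountG a b c x q (zq q) : ℝ) ≤
      cq q * ((rhoG a b c q : ℝ) * x / q) * (Λz / Real.log (zq q)) *
        (F (Real.log (x ^ (16 / 15 : ℝ) / q) / Real.log (zq q)) + C' * ε) +
      (if 0 < rhoG a b c q then cq q * Rq q else 0) := by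
    intro q hq
    obtain ⟨hq1, hqx, hcop⟩ := hQmem q hq
    rcases Nat.eq_zero_or_pos (rhoG a b c q) with hρ | hρ
    · rw [siftedCountG_eq_zero_of_rhoG_eq_zero ha.ne' hirr x hρ, if_neg (by omega), hρ]
      simp
    rw [if_pos hρ]
    obtain ⟨hu2, huMN, huzq, hua, hucop⟩ := hd7 q hq
    obtain ⟨hMN0, hMNlo, hMNhi, hMN16⟩ := hd4 q hq
    have hq0' : (0 : ℝ) < q := by exact_mod_cast hq1
    have H := (Hq x (iq q) x q hx0 (by omega) hρ (uq q) hu2 huMN hucop).1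
    dsimp only at H
    -- `S(𝒜_q, z_q) ≤ S(𝒜_q, u)`
    have hmono : (siftedCountG a b c x q (zq q) : ℝ) ≤ siftedCountG a b c x q (uq q) := by
      exact_mod_cast siftedCountG_anti x q huzq
    -- main term and `E`
    have hmain := main_term_upper_gen hVpos hΛ0pos hFf hγ hγ2 hLip hGmax hε hε1.le hε'0.le hε'ε
      hx1 hlogx (hzq q)
      ⟨hq1, hqx⟩ (hd5 q hq) hMN0 ⟨hMNlo, hMNhi⟩ (huq_eq q) (hΛ _ hua) hΛz
    have hVle := densityProd_level_le_gen hΛ0pos hγ hε hε1.le hε'0.le hε'ε hx1 (hzq q) ⟨hq1, hqx⟩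
      ⟨(hd5 q hq).1, (hd5 q hq).2.2⟩ hMN0 hMNlo (huq_eq q) (hΛ _ hua) hΛz
    have hEle : c₀ * (ε₂ + ε₂⁻¹ ^ 8 * Real.exp (K + L₂) *
        Real.log (Mi x (iq q) * Nx x) ^ (-(1 / 3 : ℝ))) ≤ c₀ * ε := by
      refine mul_le_mul_of_nonneg_left ?_ hc₀.le
      have := hE _ hMN0 hMN16
      rw [hε₂]; linarith
    have hE0 : 0 ≤ c₀ * (ε₂ + ε₂⁻¹ ^ 8 * Real.exp (K + L₂) *
        Real.log (Mi x (iq q) * Nx x) ^ (-(1 / 3 : ℝ))) :=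
      mul_nonneg hc₀.le (add_nonneg hε₂0.le (mul_nonneg (by positivity)
        (Real.rpow_nonneg (by linarith [hMN16, hL0]) _)))
    have hX0 : 0 ≤ (rhoG a b c q : ℝ) * x / q := by positivity
    have hV0 : 0 ≤ densityProdG a b c (uq q) := (hVpos _).le
    have hΛzq0 : 0 ≤ Λz / Real.log (zq q) := by
      refine div_nonneg (by linarith [hΛz_lo, hΛ0pos]) (Real.log_nonneg ?_)
      exact le_trans (by linarith) (hzq q).1
    -- combine
    have hcomb : densityProdG a b c (uq q) * ((rhoG a b c q : ℝ) * x / q) *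
        (F (Real.log (Mi x (iq q) * Nx x) / Real.log (uq q)) +
          c₀ * (ε₂ + ε₂⁻¹ ^ 8 * Real.exp (K + L₂) * Real.log (Mi x (iq q) * Nx x) ^ (-(1 / 3 : ℝ)))) ≤
        ((rhoG a b c q : ℝ) * x / q) * (Λz / Real.log (zq q)) *
          (F (Real.log (x ^ (16 / 15 : ℝ) / q) / Real.log (zq q)) + C' * ε) := by
      have h1 : densityProdG a b c (uq q) * F (Real.log (Mi x (iq q) * Nx x) / Real.log (uq q)) +
          densityProdG a b c (uq q) * (c₀ * ε) ≤
          Λz / Real.log (zq q) * (F (Real.log (x ^ (16 / 15 : ℝ) / q) / Real.log (zq q)) + C₃ * ε) +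
            Λz / Real.log (zq q) * C₄ * (c₀ * ε) :=
        add_le_add hmain (mul_le_mul_of_nonneg_right hVle (by positivity))
      have h2 : densityProdG a b c (uq q) * (F (Real.log (Mi x (iq q) * Nx x) / Real.log (uq q)) +
          c₀ * (ε₂ + ε₂⁻¹ ^ 8 * Real.exp (K + L₂) * Real.log (Mi x (iq q) * Nx x) ^ (-(1 / 3 : ℝ)))) ≤
          densityProdG a b c (uq q) * F (Real.log (Mi x (iq q) * Nx x) / Real.log (uq q)) +
            densityProdG a b c (uq q) * (c₀ * ε) := by
        rw [mul_add]; exact add_le_add le_rfl (mul_le_mul_of_nonneg_left hEle hV0)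
      have h3 := mul_le_mul_of_nonneg_left (h2.trans h1) hX0
      have e : (rhoG a b c q : ℝ) * x / q * (Λz / Real.log (zq q) *
          (F (Real.log (x ^ (16 / 15 : ℝ) / q) / Real.log (zq q)) + C₃ * ε) +
            Λz / Real.log (zq q) * C₄ * (c₀ * ε)) =
          (rhoG a b c q : ℝ) * x / q * (Λz / Real.log (zq q)) *
            (F (Real.log (x ^ (16 / 15 : ℝ) / q) / Real.log (zq q)) + C' * ε) := by
        rw [hC']; ring
      calc _ = (rhoG a b c q : ℝ) * x / q * (densityProdG a b c (uq q) * (F (Real.log (Mi x (iq q) * Nx x) /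
            Real.log (uq q)) + c₀ * (ε₂ + ε₂⁻¹ ^ 8 * Real.exp (K + L₂) *
              Real.log (Mi x (iq q) * Nx x) ^ (-(1 / 3 : ℝ))))) := by ring
        _ ≤ _ := h3
        _ = _ := e
    have hc0 : 0 ≤ cq q := (hcq q).1
    calc cq q * (siftedCountG a b c x q (zq q) : ℝ) ≤ cq q * (siftedCountG a b c x q (uq q) : ℝ) :=
          mul_le_mul_of_nonneg_left hmono hc0
      _ ≤ cq q * (densityProdG a b c (uq q) * ((rhoG a b c q : ℝ) * x / q) *
          (F (Real.log (Mi x (iq q) * Nx x) / Real.log (uq q)) +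
            c₀ * (ε₂ + ε₂⁻¹ ^ 8 * Real.exp (K + L₂) *
              Real.log (Mi x (iq q) * Nx x) ^ (-(1 / 3 : ℝ)))) + Rq q) :=
          mul_le_mul_of_nonneg_left H hc0
      _ ≤ _ := by rw [mul_add]; linarith [mul_le_mul_of_nonneg_left hcomb hc0]
  -- sum the main terms
  have hmainsum : ∑ q ∈ Q, cq q * ((rhoG a b c q : ℝ) * x / q) * (Λz / Real.log (zq q)) *
      (F (Real.log (x ^ (16 / 15 : ℝ) / q) / Real.log (zq q)) + C' * ε) =
      densityProdG a b c z * x * ∑ q ∈ Q, cq q * (rhoG a b c q : ℝ) / q *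
        F (Real.log (x ^ (16 / 15 : ℝ) / q) / Real.log (zq q)) * (Real.log z / Real.log (zq q)) +
      densityProdG a b c z * x * (C' * ε) * ∑ q ∈ Q, cq q * (rhoG a b c q : ℝ) / q * (Real.log z / Real.log (zq q)) := by
    rw [Finset.mul_sum, Finset.mul_sum, ← Finset.sum_add_distrib]
    refine Finset.sum_congr rfl fun q hq => ?_
    rw [hVz]
    have hlz0 : Real.log z ≠ 0 := by rw [hlz]; positivity
    have hlzq0 : Real.log (zq q) ≠ 0 :=
      (Real.log_pos (lt_of_lt_of_le (by linarith) (hxγ.trans (hzq q).1))).ne'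
    have hq0 : (q : ℝ) ≠ 0 := by have := (hQmem q hq).1; positivity
    field_simp
    try ring
  -- the density sum is `O_γ(1)`
  have hdens : ∑ q ∈ Q, cq q * (rhoG a b c q : ℝ) / q * (Real.log z / Real.log (zq q)) ≤ Rγ := by
    have h1 : ∀ q ∈ Q, cq q * (rhoG a b c q : ℝ) / q * (Real.log z / Real.log (zq q)) ≤ (rhoG a b c q : ℝ) / q := by
      intro q hq
      have hlzq : Real.log z ≤ Real.log (zq q) := Real.log_le_log hz0 (hzq q).1
      have hlz0 : 0 < Real.log z := by rw [hlz]; positivity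
      have hratio : Real.log z / Real.log (zq q) ≤ 1 := (div_le_one (by linarith)).mpr hlzq
      have hρq : 0 ≤ (rhoG a b c q : ℝ) / q := by positivity
      have hr0 : 0 ≤ Real.log z / Real.log (zq q) := div_nonneg hlz0.le (by linarith)
      calc cq q * (rhoG a b c q : ℝ) / q * (Real.log z / Real.log (zq q))
          = cq q * (Real.log z / Real.log (zq q)) * ((rhoG a b c q : ℝ) / q) := by ring
        _ ≤ 1 * 1 * ((rhoG a b c q : ℝ) / q) := by
            refine mul_le_mul_of_nonneg_right ?_ hρq
            exact mul_le_mul (hcq q).2 hratio hr0 zero_le_one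
        _ = (rhoG a b c q : ℝ) / q := by ring
    refine (Finset.sum_le_sum h1).trans (hR Q fun q hq => ?_)
    obtain ⟨hq1, hqx, hcop⟩ := hQmem q hq
    exact ⟨hq1, hqx.trans hxε, Nat.Coprime.coprime_dvd_right (primesProdBelow_dvd_of_le (hzq q).1) hcop⟩
  -- the remainder sum is `≤ ε V(z) x`
  have hremsum : ∑ q ∈ Q, (if 0 < rhoG a b c q then cq q * Rq q else 0) ≤ ε * (densityProdG a b c z * x) := by
    rw [← Finset.sum_filter]
    set Q' := Q.filter fun q => 0 < rhoG a b c q with hQ'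
    have hQ'sub : Q' ⊆ Q := Finset.filter_subset _ _
    set cls : ℕ → ℕ × ℕ := fun q => (iq q, jq q) with hcls
    set Kset := Q'.image cls with hKset
    rw [← Finset.sum_fiberwise_of_maps_to (s := Q') (t := Kset) (g := cls)
      (fun q hq => Finset.mem_image_of_mem cls hq)]
    -- each class contributes at most `Lmax C₁ x^{1−ε'}`
    have hclass : ∀ k ∈ Kset, ∑ q ∈ Q'.filter (fun q => cls q = k), cq q * Rq q ≤
        Lmax * C₁ * x ^ (1 - ε') := by
      intro k hk
      set T := Q'.filter (fun q => cls q = k) with hT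
      have hTmem : ∀ q ∈ T, q ∈ Q ∧ 0 < rhoG a b c q ∧ iq q = k.1 ∧ jq q = k.2 := by
        intro q hq
        rw [hT, Finset.mem_filter, hQ', Finset.mem_filter] at hq
        have h := hq.2
        simp only [hcls, Prod.ext_iff] at h
        exact ⟨hq.1.1, hq.1.2, h.1, h.2⟩
      -- rewrite `Rq q` on the fiber through `k`
      have hRq_eq : ∀ q ∈ T, Rq q = ∑ l ∈ Finset.range (Lc x k.1), RR k.1 (uk k) l q := by
        intro q hq
        obtain ⟨-, -, hi, hj⟩ := hTmem q hq
        simp only [hRq, huq, hi, hj, Prod.mk.eta]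
      rw [show ∑ q ∈ T, cq q * Rq q = ∑ q ∈ T, cq q * ∑ l ∈ Finset.range (Lc x k.1), RR k.1 (uk k) l q
        from Finset.sum_congr rfl fun q hq => by rw [hRq_eq q hq]]
      -- swap `q` and `l`
      rw [show ∑ q ∈ T, cq q * ∑ l ∈ Finset.range (Lc x k.1), RR k.1 (uk k) l q =
          ∑ l ∈ Finset.range (Lc x k.1), ∑ q ∈ T, cq q * RR k.1 (uk k) l q by
        rw [Finset.sum_comm]; exact Finset.sum_congr rfl fun q _ => Finset.mul_sum _ _ _]
      -- each `l` contributes at most `C₁ x^{1−ε'}`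
      have hl : ∀ l ∈ Finset.range (Lc x k.1), ∑ q ∈ T, cq q * RR k.1 (uk k) l q ≤ C₁ * x ^ (1 - ε') := by
        intro l _
        have hT' : ∀ q ∈ T, 0 < q ∧ q.Coprime (primesProdBelow (uk k)) ∧ (q : ℝ) * Mi x k.1 ≤ D := by
          intro q hq
          obtain ⟨hqQ, -, hi, hj⟩ := hTmem q hq
          have h7 := (hd7 q hqQ).2.2.2.2
          have h2' := (hd2 q hqQ).2
          have hk' : (iq q, jq q) = k := Prod.ext hi hj
          have hu' : uq q = uk k := by simp only [huq, hk']
          rw [hu'] at h7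
          rw [hi] at h2'
          exact ⟨(hQmem q hqQ).1, h7, h2'⟩
        have habs := abs_remainder_class_leG (a := a) (b := b) (c := c) x (uk k) (Mi x k.1) (Nx x) D T cq (au x k.1 l)
          (bu x k.1 l) hT' (fun q => abs_le.mpr ⟨by linarith [(hcq q).1], (hcq q).2⟩) (hau x k.1 l)
        obtain ⟨hb1, hb2⟩ := indicator_coeff_admissible (uk k) (hbu x k.1 l)
        have hcor := hC₁ x _ hx2 hb1 hb2
        rw [← hN, ← hNx_eq] at hcor
        exact (le_abs_self _).trans (habs.trans hcor)
      calc ∑ l ∈ Finset.range (Lc x k.1), ∑ q ∈ T, cq q * RR k.1 (uk k) l q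
          ≤ ∑ l ∈ Finset.range (Lc x k.1), C₁ * x ^ (1 - ε') := Finset.sum_le_sum hl
        _ = (Lc x k.1 : ℝ) * (C₁ * x ^ (1 - ε')) := by rw [Finset.sum_const, Finset.card_range, nsmul_eq_mul]
        _ ≤ Lmax * (C₁ * x ^ (1 - ε')) := mul_le_mul_of_nonneg_right (hLc x k.1) (by positivity)
        _ = Lmax * C₁ * x ^ (1 - ε') := by ring
    -- number of classes
    have hKcard : (Kset.card : ℝ) ≤ ((⌊Real.logb 2 x⌋₊ : ℝ) + 1) ^ 2 := by
      have hsub : Kset ⊆ Finset.range (⌊Real.logb 2 x⌋₊ + 1) ×ˢ Finset.range (⌊Real.logb 2 x⌋₊ + 1) := by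
        intro k hk
        obtain ⟨q, hq, rfl⟩ := Finset.mem_image.mp hk
        have hqQ : q ∈ Q := hQ'sub hq
        rw [Finset.mem_product, Finset.mem_range, Finset.mem_range]
        exact ⟨Nat.lt_succ_of_le (hd6 q hqQ).1, Nat.lt_succ_of_le (hd6 q hqQ).2⟩
      have := Finset.card_le_card hsub
      rw [Finset.card_product, Finset.card_range] at this
      have h' : (Kset.card : ℝ) ≤ ((⌊Real.logb 2 x⌋₊ + 1 : ℕ) : ℝ) * ((⌊Real.logb 2 x⌋₊ + 1 : ℕ) : ℝ) := by
        exact_mod_cast this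
      push_cast at h'
      calc (Kset.card : ℝ) ≤ _ := h'
        _ = ((⌊Real.logb 2 x⌋₊ : ℝ) + 1) ^ 2 := by ring
    calc ∑ k ∈ Kset, ∑ q ∈ Q'.filter (fun q => cls q = k), cq q * Rq q
        ≤ ∑ k ∈ Kset, Lmax * C₁ * x ^ (1 - ε') := Finset.sum_le_sum hclass
      _ = (Kset.card : ℝ) * (Lmax * C₁ * x ^ (1 - ε')) := by rw [Finset.sum_const, nsmul_eq_mul]
      _ ≤ ((⌊Real.logb 2 x⌋₊ : ℝ) + 1) ^ 2 * (Lmax * C₁ * x ^ (1 - ε')) :=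
          mul_le_mul_of_nonneg_right hKcard (by positivity)
      _ = ((⌊Real.logb 2 x⌋₊ : ℝ) + 1) ^ 2 * (Lmax * C₁) * x ^ (1 - ε') := by ring
      _ ≤ (ε * (7 / 8 * lambda0G a b c) / γ) * x / Real.log x := hrem
      _ ≤ ε * (densityProdG a b c z * x) := by
          rw [hVz, hlz, div_le_iff₀ hL0]
          have : ε * (7 / 8 * lambda0G a b c) / γ * x =
              ε * ((7 / 8 * lambda0G a b c) / (γ * L) * x) * L := by
            field_simp
          rw [this]
          refine mul_le_mul_of_nonneg_right (mul_le_mul_of_nonneg_left ?_ hε.le) hL0.le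
          exact mul_le_mul_of_nonneg_right (div_le_div_of_nonneg_right hΛz_lo (by positivity)) hx0.le
  -- conclusion
  have htotal := Finset.sum_le_sum hkey
  rw [Finset.sum_add_distrib, hmainsum] at htotal
  have hVx : 0 ≤ densityProdG a b c z * x := mul_nonneg (hVpos _).le hx0.le
  have hC'0 : 0 ≤ C' := by positivity
  have hA : densityProdG a b c z * x * (C' * ε) * ∑ q ∈ Q, cq q * (rhoG a b c q : ℝ) / q * (Real.log z / Real.log (zq q)) ≤
      densityProdG a b c z * x * (C' * ε) * Rγ :=
    mul_le_mul_of_nonneg_left hdens (mul_nonneg hVx (mul_nonneg hC'0 hε.le))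
  calc ∑ q ∈ Q, cq q * (siftedCountG a b c x q (zq q) : ℝ) ≤ _ := htotal
    _ ≤ densityProdG a b c z * x * ∑ q ∈ Q, cq q * (rhoG a b c q : ℝ) / q *
          F (Real.log (x ^ (16 / 15 : ℝ) / q) / Real.log (zq q)) * (Real.log z / Real.log (zq q)) +
        densityProdG a b c z * x * (C' * ε) * Rγ + ε * (densityProdG a b c z * x) := by
          linarith [hA, hremsum]
    _ = densityProdG a b c z * x * (∑ q ∈ Q, cq q * (rhoG a b c q : ℝ) / q *
          F (Real.log (x ^ (16 / 15 : ℝ) / q) / Real.log (zq q)) * (Real.log z / Real.log (zq q)) +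
        ((C₃ + c₀ * C₄) * Rγ + 1) * ε) := by rw [hC']; ring


end Literature.NumberTheory.Sieve.Iwaniec1978

end
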